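import Mathlib
import HarnessLib
import Summits.ValiantsHypothesis.ValiantsHypothesis.Theorems.MonotoneRestorationOrbitRestorationQPDepthThreeRungDefs
import Summits.ValiantsHypothesis.ValiantsHypothesis.Theorems.MonotoneRestorationOrbitRestorationQPPiSigmaClass
import Summits.ValiantsHypothesis.ValiantsHypothesis.Theorems.MonotoneRestorationOrbitRestorationQPPerNotNarrow
import Summits.ValiantsHypothesis.ValiantsHypothesis.Theorems.MonotoneRestorationOrbitRestorationQPColumnVandermondesNarrowSpan
import Summits.ValiantsHypothesis.ValiantsHypothesis.Theorems.MonotoneRestorationOrbitRestorationQPNarrowSpanAlgebra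

/-!
# The column-Vandermonde product as a CERTIFIED INSTANCE of A_∞ in SPAN currency (constant treewidth)

Route MonotoneRestoration, crux `OrbitRestorationQP` (stmt-ValiantsHypothesis-18293), line `depth-three-rung`,
open sub-rung A_∞ = `stub_sigmaPiSigmaValue` (vocabulary of `…DepthThreeRungDefs.lean`: `IsMatrixSymmetric`,
`PDClass`, `QPOrbitRestorable`).  Helper (`--supports`), def-free.

THE FAMILY `F n := if Even n then W_n else 0`, `W_n := Π_{q<n} Π_{i<i'} (x_{i'q} − x_{iq})` (product of the `n`
column Vandermondes; the unique twisted line-orbit of the `ΠΣ` sub-rung, cf. the evidence note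
`SPAN-CURRENCY-A1-g7g4.md` on the crux item).  This file certifies, by name and in the kernel:

* `rename_prod_colVandermonde` — `(σ, τ) · W_n = sign(σ)^n · W_n`; hence `isMatrixSymmetric_family`:
  `F` IS MATRIX-SYMMETRIC (the hypothesis of A_∞);
* `pdClass_family` — every `F n` lies in the `ΣΠΣ` slice `PDClass (fun _ => 1) n 20` (one `ΠΣ` term with
  `n·C(n,2) ≤ n³` affine factors; `PiSigmaClass.pdClass_one_affineProd`) — the second hypothesis of A_∞;
* `prod_colVandermonde_mem_narrowSpan` / `mem_narrowSpan_family` — every `F n` lies in the `ℂ`-SPAN of the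
  homomorphism polynomials of bipartite patterns of treewidth `≤ 2` (volume unbounded): the span-currency
  certificate with CONSTANT treewidth (`ColumnVandermondesNarrow.prod_colVandermonde_mem_of_biColumn` +
  `NarrowSpanAlgebra.mem_narrowSpan_of_mem_adjoin`);
* `qpOrbitRestorable_family` — hence `QPOrbitRestorable 5 n (F n)` for all `n`, through
  `OrbitRestorationQPHomPolyClose.qpOrbit_of_mem_narrowSpan` (K2 + K3, landed): the CONCLUSION of A_∞ for `F`,
  obtained in span currency (not through the orbit-currency pairing of the landed A₁);
* `sigmaPiSigmaValue_holds_family` — the registered stub's hypotheses AND conclusion for `F`, packaged.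

Honest label: one explicit family (the test case of the twisted residue); the stub A_∞, the crux and VP ≠ VNP are
not moved.
-/

noncomputable section

-- `Summit.ValiantsHypothesis.ValiantsHypothesis.…` is the tree's single-conjunct layout (Sub = Summit).
set_option linter.dupNamespace false

namespace Summit.ValiantsHypothesis.ValiantsHypothesis.Theorems

namespace ColumnVandermondesInstance

open MvPolynomial Finset Matrix Equiv
open Literature.Computability.AlgebraicComplexity (homPoly)
open Literature.Combinatorics.SimpleGraph (treewidth)
open OrbitRestorationQPDepthThreeRung (IsMatrixSymmetric PDClass QPOrbitRestorable)

/-! ### Matrix symmetry -/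

/-- **Row and column permutations act on the column-Vandermonde product by `sign(σ)^n`.** [folklore] -/
theorem rename_prod_colVandermonde (n : ℕ) (σ τ : Perm (Fin n)) :
    rename (fun p : Fin n × Fin n => (σ p.1, τ p.2))
        (∏ q : Fin n, ∏ i : Fin n, ∏ i' ∈ Ioi i,
          ((X (i', q) : MvPolynomial (Fin n × Fin n) ℂ) - X (i, q))) =
      (((Equiv.Perm.sign σ : ℤ) : MvPolynomial (Fin n × Fin n) ℂ)) ^ n *
        ∏ q : Fin n, ∏ i : Fin n, ∏ i' ∈ Ioi i,
          ((X (i', q) : MvPolynomial (Fin n × Fin n) ℂ) - X (i, q)) := by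
  have hcol : ∀ q : Fin n, ∏ i : Fin n, ∏ i' ∈ Ioi i,
      (rename (fun p : Fin n × Fin n => (σ p.1, τ p.2))
        ((X (i', q) : MvPolynomial (Fin n × Fin n) ℂ) - X (i, q))) =
      (((Equiv.Perm.sign σ : ℤ) : MvPolynomial (Fin n × Fin n) ℂ)) *
        ∏ i : Fin n, ∏ i' ∈ Ioi i, ((X (i', τ q) : MvPolynomial (Fin n × Fin n) ℂ) - X (i, τ q)) := by
    intro q
    simp only [map_sub, rename_X]
    exact Equiv.Perm.prod_Ioi_comp_eq_sign_mul_prod σ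
      (f := fun i i' => ((X (i', τ q) : MvPolynomial (Fin n × Fin n) ℂ) - X (i, τ q)))
      fun i i' => (neg_sub _ _).symm
  simp only [map_prod]
  simp_rw [hcol]
  rw [Finset.prod_mul_distrib, Finset.prod_const, Finset.card_univ, Fintype.card_fin]
  congr 1
  exact Equiv.prod_comp τ (fun q : Fin n => ∏ i : Fin n, ∏ i' ∈ Ioi i,
    ((X (i', q) : MvPolynomial (Fin n × Fin n) ℂ) - X (i, q)))

/-- **The family `F n := if Even n then W_n else 0` is matrix-symmetric** (`sign(σ)^n = 1` for even `n`).
[folklore] -/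
theorem isMatrixSymmetric_family :
    IsMatrixSymmetric fun n => if Even n then
      ∏ q : Fin n, ∏ i : Fin n, ∏ i' ∈ Ioi i, ((X (i', q) : MvPolynomial (Fin n × Fin n) ℂ) - X (i, q))
      else 0 := by
  intro n σ τ
  by_cases hn : Even n
  · simp only [if_pos hn]
    rw [rename_prod_colVandermonde]
    obtain ⟨m, hm⟩ := hn
    have hs : (((Equiv.Perm.sign σ : ℤ) : MvPolynomial (Fin n × Fin n) ℂ)) ^ n = 1 := by
      have h1 : (((Equiv.Perm.sign σ : ℤ) : MvPolynomial (Fin n × Fin n) ℂ)) *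
          (((Equiv.Perm.sign σ : ℤ) : MvPolynomial (Fin n × Fin n) ℂ)) = 1 := by
        rw [← Int.cast_mul, ← Units.val_mul, Int.units_mul_self, Units.val_one, Int.cast_one]
      have e : (((Equiv.Perm.sign σ : ℤ) : MvPolynomial (Fin n × Fin n) ℂ)) ^ n =
          (((Equiv.Perm.sign σ : ℤ) : MvPolynomial (Fin n × Fin n) ℂ)) ^ (2 * m) :=
        congrArg (fun k : ℕ => (((Equiv.Perm.sign σ : ℤ) : MvPolynomial (Fin n × Fin n) ℂ)) ^ k)
          (by omega)
      rw [e, pow_mul, sq, h1, one_pow]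
    rw [hs, one_mul]
  · simp only [if_neg hn, map_zero]

/-! ### The `ΣΠΣ` slice -/

/-- The column-Vandermonde product is the product of the multiset of its `n · C(n,2)` affine factors.
[folklore] -/
theorem prod_colVandermonde_eq_multiset_prod (n : ℕ) :
    (∏ q : Fin n, ∏ i : Fin n, ∏ i' ∈ Ioi i, ((X (i', q) : MvPolynomial (Fin n × Fin n) ℂ) - X (i, q))) =
      ((univ : Finset (Fin n)).val.bind fun q => (univ : Finset (Fin n)).val.bind fun i =>
        (Ioi i).val.map fun i' => ((X (i', q) : MvPolynomial (Fin n × Fin n) ℂ) - X (i, q))).prod := by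
  simp only [Multiset.prod_bind, Finset.prod_eq_multiset_prod]

/-- The multiset of affine factors has at most `n³` members. [folklore] -/
theorem card_factors_le (n : ℕ) :
    Multiset.card ((univ : Finset (Fin n)).val.bind fun q => (univ : Finset (Fin n)).val.bind fun i =>
        (Ioi i).val.map fun i' => ((X (i', q) : MvPolynomial (Fin n × Fin n) ℂ) - X (i, q))) ≤ n ^ 3 := by
  simp only [Multiset.card_bind, Multiset.card_map, Function.comp_def, Finset.card_val]
  rw [← Finset.sum_eq_multiset_sum]
  simp_rw [← Finset.sum_eq_multiset_sum]
  calc ∑ _q : Fin n, ∑ i : Fin n, (Ioi i).card ≤ ∑ _q : Fin n, ∑ _i : Fin n, n :=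
        Finset.sum_le_sum fun q _ => Finset.sum_le_sum fun i _ =>
          (Finset.card_le_univ _).trans (by simp)
    _ = n ^ 3 := by simp; ring

/-- **Every member of the family lies in the `ΣΠΣ` slice `PDClass (fun _ => 1) n 20`.** [folklore; cite:
LimayeSrinivasanTavenas2021, §1] -/
theorem pdClass_family (n : ℕ) :
    PDClass (fun _ => 1) n 20 (if Even n then
      ∏ q : Fin n, ∏ i : Fin n, ∏ i' ∈ Ioi i, ((X (i', q) : MvPolynomial (Fin n × Fin n) ℂ) - X (i, q))
      else 0) := by
  by_cases hn : Even n
  · rw [if_pos hn, prod_colVandermonde_eq_multiset_prod]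
    refine PiSigmaClass.pdClass_one_affineProd (c := 3) _ (fun p hp => ?_)
      ((card_factors_le n).trans (Nat.le_add_right _ _))
    simp only [Multiset.mem_bind, Multiset.mem_map, Finset.mem_val] at hp
    obtain ⟨q, -, i, -, i', -, rfl⟩ := hp
    refine (totalDegree_sub _ _).trans (max_le ?_ ?_) <;> exact (totalDegree_X _).le
  · rw [if_neg hn]
    have h := PiSigmaClass.pdClass_one_affineProd (n := n) (c := 3)
      ({(0 : MvPolynomial (Fin n × Fin n) ℂ)} : Multiset (MvPolynomial (Fin n × Fin n) ℂ))
      (fun p hp => by rw [Multiset.mem_singleton.1 hp, totalDegree_zero]; exact Nat.zero_le _)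
      (by simp)
    simpa using h

/-! ### SPAN currency: treewidth `≤ 2`, every even level -/

/-- **`W_n` lies in the span of the homomorphism polynomials of treewidth `≤ 2` (every even `n`).**
[cite: DwivediPagoSeppelt2026, eq. (1) and §8] -/
theorem prod_colVandermonde_mem_narrowSpan (n : ℕ) (hn : Even n) :
    (∏ q : Fin n, ∏ i : Fin n, ∏ i' ∈ Ioi i, ((X (i', q) : MvPolynomial (Fin n × Fin n) ℂ) - X (i, q))) ∈
      Submodule.span ℂ {p : MvPolynomial (Fin n × Fin n) ℂ |
        ∃ (a b : ℕ) (E : Multiset (Fin a × Fin b)),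
          treewidth (SimpleGraph.fromRel fun u v : Fin a ⊕ Fin b =>
            ∃ e ∈ E, u = Sum.inl e.1 ∧ v = Sum.inr e.2) ≤ 2 ∧ p = homPoly E n ℂ} := by
  have h := ColumnVandermondesNarrow.prod_colVandermonde_mem_of_biColumn n hn
    (Algebra.adjoin ℂ {p : MvPolynomial (Fin n × Fin n) ℂ |
        ∃ (a b : ℕ) (E : Multiset (Fin a × Fin b)),
          treewidth (SimpleGraph.fromRel fun u v : Fin a ⊕ Fin b =>
            ∃ e ∈ E, u = Sum.inl e.1 ∧ v = Sum.inr e.2) ≤ 2 ∧ p = homPoly E n ℂ})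
    (fun N f => Algebra.subset_adjoin ⟨N, 2, _,
      ColumnVandermondesNarrow.treewidth_biColumnPattern_le_two N f,
      (ColumnVandermondesNarrow.homPoly_biColumnPattern n N f).symm⟩)
  simp_rw [det_vandermonde] at h
  exact NarrowSpanAlgebra.mem_narrowSpan_of_mem_adjoin n 2 h

/-- Every member of the family lies in the treewidth-`≤ 2` span. [folklore] -/
theorem mem_narrowSpan_family (n : ℕ) :
    (if Even n then
      ∏ q : Fin n, ∏ i : Fin n, ∏ i' ∈ Ioi i, ((X (i', q) : MvPolynomial (Fin n × Fin n) ℂ) - X (i, q))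
      else 0) ∈
      Submodule.span ℂ {p : MvPolynomial (Fin n × Fin n) ℂ |
        ∃ (a b : ℕ) (E : Multiset (Fin a × Fin b)),
          treewidth (SimpleGraph.fromRel fun u v : Fin a ⊕ Fin b =>
            ∃ e ∈ E, u = Sum.inl e.1 ∧ v = Sum.inr e.2) ≤ 2 ∧ p = homPoly E n ℂ} := by
  by_cases hn : Even n
  · rw [if_pos hn]; exact prod_colVandermonde_mem_narrowSpan n hn
  · rw [if_neg hn]; exact Submodule.zero_mem _

/-! ### The conclusion of A_∞ for the family, through K2 + K3 -/

/-- **The family is quasi-polynomially orbit-restorable with constant `5`**, from the span certificate through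
`qpOrbit_of_mem_narrowSpan` (treewidth `2 ≤ (log₂ n + 2)²`). [cite: DawarPagoSeppelt2025, Thm 1.1] -/
theorem qpOrbitRestorable_family (n : ℕ) :
    QPOrbitRestorable 5 n (if Even n then
      ∏ q : Fin n, ∏ i : Fin n, ∏ i' ∈ Ioi i, ((X (i', q) : MvPolynomial (Fin n × Fin n) ℂ) - X (i, q))
      else 0) := by
  have hmono : ∀ k : ℕ, Submodule.span ℂ {p : MvPolynomial (Fin k × Fin k) ℂ |
        ∃ (a b : ℕ) (E : Multiset (Fin a × Fin b)),
          treewidth (SimpleGraph.fromRel fun u v : Fin a ⊕ Fin b =>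
            ∃ e ∈ E, u = Sum.inl e.1 ∧ v = Sum.inr e.2) ≤ 2 ∧ p = homPoly E k ℂ} ≤
      Submodule.span ℂ {p : MvPolynomial (Fin k × Fin k) ℂ |
        ∃ (a b : ℕ) (E : Multiset (Fin a × Fin b)),
          treewidth (SimpleGraph.fromRel fun u v : Fin a ⊕ Fin b =>
            ∃ e ∈ E, u = Sum.inl e.1 ∧ v = Sum.inr e.2) ≤ (Nat.log 2 k + 2) ^ 2 ∧ p = homPoly E k ℂ} := by
    intro k
    refine Submodule.span_mono ?_
    rintro p ⟨a, b, E, hE, rfl⟩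
    refine ⟨a, b, E, hE.trans ?_, rfl⟩
    calc 2 ≤ Nat.log 2 k + 2 := Nat.le_add_left 2 _
      _ ≤ (Nat.log 2 k + 2) ^ 2 := Nat.le_self_pow (by norm_num) _
  have h := OrbitRestorationQPHomPolyClose.qpOrbit_of_mem_narrowSpan
    (fun k => if Even k then
      ∏ q : Fin k, ∏ i : Fin k, ∏ i' ∈ Ioi i, ((X (i', q) : MvPolynomial (Fin k × Fin k) ℂ) - X (i, q))
      else 0) 2 (fun k => hmono k (mem_narrowSpan_family k)) n
  exact h

/-- **PACKAGED: the registered stub A_∞ (`stub_sigmaPiSigmaValue`) holds for this family — both hypotheses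
(matrix symmetry, `ΣΠΣ` slice) and the conclusion (quasi-polynomial orbits), the conclusion certified in SPAN
currency with constant treewidth `2`.** [folklore] -/
theorem sigmaPiSigmaValue_holds_family :
    IsMatrixSymmetric (fun n => if Even n then
      ∏ q : Fin n, ∏ i : Fin n, ∏ i' ∈ Ioi i, ((X (i', q) : MvPolynomial (Fin n × Fin n) ℂ) - X (i, q))
      else 0) ∧
    (∃ c : ℕ, ∀ n : ℕ, PDClass (fun _ => 1) n c (if Even n then
      ∏ q : Fin n, ∏ i : Fin n, ∏ i' ∈ Ioi i, ((X (i', q) : MvPolynomial (Fin n × Fin n) ℂ) - X (i, q))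
      else 0)) ∧
    ∃ c : ℕ, ∀ n : ℕ, QPOrbitRestorable c n (if Even n then
      ∏ q : Fin n, ∏ i : Fin n, ∏ i' ∈ Ioi i, ((X (i', q) : MvPolynomial (Fin n × Fin n) ℂ) - X (i, q))
      else 0) :=
  ⟨isMatrixSymmetric_family, ⟨20, pdClass_family⟩, ⟨5, qpOrbitRestorable_family⟩⟩

end ColumnVandermondesInstance

end Summit.ValiantsHypothesis.ValiantsHypothesis.Theorems

end
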